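import Literature.NumberTheory.LFunctions.XiDerivativeZeros
import Literature.NumberTheory.LFunctions.LagariasXiPositivityEq14Proofs
import Literature.NumberTheory.LFunctions.RiemannXiLogDeriv
import HarnessLib

/-!
# Zeros of `ξ′` on the critical line under RH — proof (Conrey 1983, p. 49; Levinson–Montgomery)

RH-CONSEQUENCE, proved with its `RiemannHypothesis →` binder. Proofs file for
`Literature/NumberTheory/LFunctions/XiDerivativeZeros.lean`: the heredity statement
`riemannHypothesis_imp_xiDeriv_zeros_on_line` ("the Riemann hypothesis implies that all of the zeros
of `ξ′(s)` have real part `½`", J. B. Conrey, J. Number Theory 16 (1983), p. 49) is DISCHARGED: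
`riemannHypothesis_imp_xiDeriv_zeros_on_line_holds`.

Proof (the printed one): under RH, `Re ξ′(s)/ξ(s) > 0` for `Re s > ½` — this is Lagarias' criterion
(1.5), in the tree as `Lagarias1999_riemannHypothesis_iff_holds` (Hadamard product, pairing of
`ρ` with `1 − ρ̄`) — so `ξ′(s) ≠ 0` there (Mathlib's `logDeriv ξ s = ξ′(s)/ξ(s)` would vanish); and the
functional equation `ξ(1 − s) = ξ(s)` gives `ξ′(1 − s) = −ξ′(s)` (tree `deriv_riemannXi_one_sub`), which
transports the statement to `Re s < ½`. WHAT THIS IS NOT: nothing here asserts RH or bears on its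
truth; the theorem is an implication with RH as hypothesis.

## References

* J. B. Conrey, *Zeros of derivatives of Riemann's ξ-function on the critical line*, J. Number
  Theory 16 (1983) 49–74, §1 p. 49. [cite: Conrey1983, §1 (p. 49)]
* J. C. Lagarias, *On a positivity property of the Riemann ξ-function*, Acta Arith. 89 (1999)
  217–234, eq. (1.5). [cite: LagariasXiPositivity1999, eq. (1.5)]
-/

noncomputable section

namespace Literature.NumberTheory.LFunctions

namespace XiDerivZeros

/-- Under RH, `ξ′(s) ≠ 0` for `Re s > ½` (`Re ξ′/ξ > 0` there, Lagarias (1.5)).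
[cite: LagariasXiPositivity1999, eq. (1.5)] -/
theorem deriv_riemannXi_ne_zero_of_rh (hRH : RiemannHypothesis) {s : ℂ} (hs : 1 / 2 < s.re) :
    deriv riemannXi s ≠ 0 := by
  intro h0
  have hpos := Lagarias1999_riemannHypothesis_iff_holds.1 hRH s hs
  rw [logDeriv_apply, h0, zero_div, Complex.zero_re] at hpos
  exact lt_irrefl _ hpos

end XiDerivZeros

/-- **Discharge of `riemannHypothesis_imp_xiDeriv_zeros_on_line`** (Conrey 1983, p. 49, `m = 1`):
under RH every zero of `ξ′` has real part `½`. [cite: Conrey1983, §1 (p. 49)] -/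
theorem riemannHypothesis_imp_xiDeriv_zeros_on_line_holds :
    riemannHypothesis_imp_xiDeriv_zeros_on_line := by
  intro hRH s hs
  rcases lt_trichotomy s.re (1 / 2) with hlt | heq | hgt
  · exfalso
    refine XiDerivZeros.deriv_riemannXi_ne_zero_of_rh hRH (s := 1 - s) ?_ ?_
    · simp only [Complex.sub_re, Complex.one_re]; linarith
    · rw [deriv_riemannXi_one_sub, hs, neg_zero]
  · exact heq
  · exact absurd hs (XiDerivZeros.deriv_riemannXi_ne_zero_of_rh hRH hgt)

end Literature.NumberTheory.LFunctions

end
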